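import Mathlib
import Summits.QuantumFields.BalabanUV.Beta.UnitLatticePartitionProfile
import Summits.QuantumFields.BalabanUV.Beta.UnitLatticeTubeCount

/-!
# `Summit.QuantumFields.BalabanUV.Beta.UnitLatticePartition` — INSTANCE DATA for route A.3′: a CONCRETE partition
# `h_b(z) = Π_i f_M(z_i − b_iM)` on boxes of `ℤ^ν` with `Σ_b h_b² = 1` EXACTLY, supports in sup-cubes of radius `M`
# (diameter `≤ 2M`), `|h_b| ≤ 1`, Lipschitz constant `νπ/(2M)` for the sup-distance, and overlap `≤ 2^ν` — the partition
# binders of `UnitLatticeWalkInversion` … `UnitLatticeOmegaRowData` ∕ `AnalyticWalkSum216RowResolvent` DISCHARGED for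
# unit-lattice sites embedded in a box `[0, qM]^ν`

HONEST FRAMING (page 1 of everything in this cell).  Discharging `FlowStep.BetaPertH` would make Bałaban's ultraviolet
stability UNCONDITIONAL — a constructive-QFT result; NOT the continuum limit, NOT the Clay problem.  This module
discharges nothing of `BetaPertH`; [folklore], kernel-checked (unit `b2b-balaban-beta-d4-p3`, road P3, gen 4; part of the
instance dictionary R_A of route A.3′ — the PARTITION DATA — made kernel; the kernel pieces, cells∕threads of Bałaban's
operators and all budgets remain hypotheses of the owner's THEOREM B).  Box with free boundary (sites embedded in
`[0, qM]^ν ⊆ ℤ^ν`, sup-distance `UnitLatticeTubeCount.supDistOn`); the torus-periodic twin is NOT here.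
CONTEXT (located, not used): [I] = CMP **109** (1987) p. 270 below (3.1): *"ζ_□(x) = Π_{μ=1}^{d} ζ(M⁻¹(x_μ − y_μ))"*.
HONEST DEPENDENCY: continuum YM on T⁴ ⇐ BetaPertH ∧ nine spine estimates (0/9 proved); BetaPertH ⇐
(D1) ∧ (D4) ∧ CAP+tail; G-an2-4 gates asym, D1 and NE2/3/4.

CONTENTS (0 sorry).  §1 products of numbers of modulus `≤ 1` (`abs_prod_le_one`; the telescoping bound is inlined in §2).  §2 `ctr`,
`hcube M b z = Π_i bump M (z_i − b_iM)`, `abs_hcube_le_one`, `hcube_eq_zero_of_le_supDist`, **`sum_hcube_sq_eq_one`**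
(`Σ_{b : Fin ν → Fin (q+1)} hcube² = 1` on the box — `Finset.prod_univ_sum` + the 1-D identity), **`abs_hcube_sub_hcube_le`**
(`≤ ν·(π/(2M))·supDist z z′`).  §3 overlap: `card_near_le_two` (per axis at most TWO centres `jM` lie strictly within `M`
of a point), **`card_overlap_le`** (`≤ 2^ν`).  §4 THE BINDERS for sites `e : Y → ℤ^ν` in the box: `hPart`, `EPart` and
`hPart_sq_sum`, `hPart_supp`, `abs_hPart_le`, `hPart_lipschitz`, `card_EPart_filter_le`, `diam_EPart_le` — exactly the
shapes `hsum`, `hsupp`, `habs`, `hLip` (with `M_eff = 2M/(νπ)`), `hN` (`N = 2^ν`), `hdiam` (`D = 2M`) of the spine.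
NOT HERE: torus-periodic version; near families, cells, threads, kernels (other binders of R_A).  NOT summit progress.
-/

open scoped BigOperators
open Finset Real

namespace Summit.QuantumFields.BalabanUV.Beta.UnitLatticePartition

open Summit.QuantumFields.BalabanUV.Beta.UnitLatticePartitionProfile
  (bump abs_bump_le_one bump_of_le_abs abs_bump_sub_bump_le sum_bump_sq_eq_one)
open Summit.QuantumFields.BalabanUV.Beta.UnitLatticeTubeCount (supDist supDistOn supDist_le_iff supDist_triangle)

noncomputable section

variable {ν : ℕ}

/-! ## §1 Products of numbers of modulus at most one -/

/-- `|Π a_i| ≤ 1` when every `|a_i| ≤ 1`. [folklore] -/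
theorem abs_prod_le_one {ι : Type*} (s : Finset ι) (a : ι → ℝ) (ha : ∀ i ∈ s, |a i| ≤ 1) : |∏ i ∈ s, a i| ≤ 1 := by
  rw [Finset.abs_prod]
  exact Finset.prod_le_one (fun i _ => abs_nonneg _) ha

/-! ## §2 The cube functions -/

/-- The CENTRE of the cube labelled `b`: `(b_i·M)_i`. [folklore] -/
def ctr (M : ℕ) (b : Fin ν → ℤ) : Fin ν → ℤ := fun i => b i * M

/-- THE CUBE FUNCTION `h_b(z) = Π_i f_M(z_i − b_iM)` ([I] p. 270's product form, with the cosine profile). [folklore] -/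
def hcube (M : ℕ) (b : Fin ν → ℤ) (z : Fin ν → ℤ) : ℝ := ∏ i, bump M ((z i : ℝ) - (b i : ℝ) * M)

/-- `|h_b| ≤ 1`. [folklore] -/
theorem abs_hcube_le_one (M : ℕ) (b z : Fin ν → ℤ) : |hcube M b z| ≤ 1 :=
  abs_prod_le_one _ _ fun _ _ => abs_bump_le_one _ _

/-- The distance to the centre in one coordinate, as a real number. [folklore] -/
theorem abs_coord_sub_ctr (M : ℕ) (b z : Fin ν → ℤ) (i : Fin ν) :
    |(z i : ℝ) - (b i : ℝ) * M| = ((z i - ctr M b i).natAbs : ℝ) := by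
  rw [Nat.cast_natAbs, Int.cast_abs]
  push_cast [ctr]
  ring_nf

/-- `h_b(z) = 0` as soon as `supDist z (ctr b) ≥ M` (some coordinate is at distance `≥ M` from the centre). [folklore] -/
theorem hcube_eq_zero_of_le_supDist {M : ℕ} (hM : 0 < M) {b z : Fin ν → ℤ} (h : M ≤ supDist z (ctr M b)) :
    hcube M b z = 0 := by
  obtain ⟨i, _, hi⟩ := (Finset.le_sup_iff (bot_lt_iff_ne_bot.2 (Nat.pos_iff_ne_zero.1 hM))).1 h
  refine Finset.prod_eq_zero (Finset.mem_univ i) (bump_of_le_abs (by exact_mod_cast hM) ?_)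
  rw [abs_coord_sub_ctr]
  exact_mod_cast hi

/-- **`Σ_b h_b(z)² = 1`** for `z` in the box `[0, qM]^ν`, the sum over the cube labels `b : Fin ν → Fin (q+1)`
(`Finset.prod_univ_sum` and the 1-D identity `sum_bump_sq_eq_one` in each coordinate). [folklore] -/
theorem sum_hcube_sq_eq_one {M : ℕ} (hM : 0 < M) (q : ℕ) (z : Fin ν → ℤ) (hz : ∀ i, 0 ≤ z i ∧ z i ≤ q * M) :
    ∑ b : Fin ν → Fin (q + 1), hcube M (fun i => (b i : ℤ)) z ^ 2 = 1 := by
  have hM' : (0 : ℝ) < M := by exact_mod_cast hM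
  have h1 : ∀ i : Fin ν, ∑ j : Fin (q + 1), bump M ((z i : ℝ) - ((j : ℕ) : ℝ) * M) ^ 2 = 1 := by
    intro i
    rw [Fin.sum_univ_eq_sum_range (fun j => bump M ((z i : ℝ) - (j : ℝ) * M) ^ 2) (q + 1)]
    exact sum_bump_sq_eq_one hM' q (z i) (by exact_mod_cast (hz i).1) (by exact_mod_cast (hz i).2)
  calc ∑ b : Fin ν → Fin (q + 1), hcube M (fun i => (b i : ℤ)) z ^ 2
      = ∑ b : Fin ν → Fin (q + 1), ∏ i, bump M ((z i : ℝ) - ((b i : ℕ) : ℝ) * M) ^ 2 := by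
        refine Finset.sum_congr rfl fun b _ => ?_
        rw [hcube, ← Finset.prod_pow]
        push_cast
        rfl
    _ = ∏ i : Fin ν, ∑ j : Fin (q + 1), bump M ((z i : ℝ) - ((j : ℕ) : ℝ) * M) ^ 2 := by
        rw [Finset.prod_univ_sum, Fintype.piFinset_univ]
    _ = 1 := by rw [Finset.prod_congr rfl fun i _ => h1 i, Finset.prod_const_one]

/-- One coordinate difference is bounded by the sup-distance. [folklore] -/
theorem abs_sub_le_supDist (z z' : Fin ν → ℤ) (i : Fin ν) : |(z i : ℝ) - (z' i : ℝ)| ≤ (supDist z z' : ℝ) := by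
  have h : (z i - z' i).natAbs ≤ supDist z z' := (supDist_le_iff.1 le_rfl) i
  have e : |(z i : ℝ) - (z' i : ℝ)| = ((z i - z' i).natAbs : ℝ) := by
    rw [Nat.cast_natAbs, Int.cast_abs, Int.cast_sub]
  rw [e]
  exact_mod_cast h

/-- **THE LIPSCHITZ BOUND**: `|h_b(z) − h_b(z′)| ≤ ν·(π/(2M))·supDist(z, z′)` (telescoping the product — the tree's
`WalshDyadic.abs_prod_sub_prod_le` pattern, inlined — and the 1-D Lipschitz bound in each coordinate). [folklore] -/
theorem abs_hcube_sub_hcube_le {M : ℕ} (hM : 0 < M) (b z z' : Fin ν → ℤ) :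
    |hcube M b z - hcube M b z'| ≤ ν * (π / (2 * M)) * (supDist z z' : ℝ) := by
  have hM' : (0 : ℝ) < M := by exact_mod_cast hM
  set a : Fin ν → ℝ := fun i => bump M ((z i : ℝ) - (b i : ℝ) * M) with ha
  set a' : Fin ν → ℝ := fun i => bump M ((z' i : ℝ) - (b i : ℝ) * M) with ha'
  -- telescoping: |Π a − Π a′| ≤ Σ |a − a′| for factors of modulus ≤ 1
  have key : ∀ s : Finset (Fin ν), |∏ i ∈ s, a i - ∏ i ∈ s, a' i| ≤ ∑ i ∈ s, |a i - a' i| := by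
    intro s
    induction s using Finset.induction_on with
    | empty => simp
    | insert j s hj ih =>
        rw [Finset.prod_insert hj, Finset.prod_insert hj, Finset.sum_insert hj]
        have hP : |∏ i ∈ s, a i| ≤ 1 := abs_prod_le_one s a fun i _ => abs_bump_le_one _ _
        have h1 : |a' j| ≤ 1 := abs_bump_le_one _ _
        have hsplit : a j * ∏ i ∈ s, a i - a' j * ∏ i ∈ s, a' i
            = (a j - a' j) * ∏ i ∈ s, a i + a' j * (∏ i ∈ s, a i - ∏ i ∈ s, a' i) := by ring
        rw [hsplit]
        calc |(a j - a' j) * ∏ i ∈ s, a i + a' j * (∏ i ∈ s, a i - ∏ i ∈ s, a' i)|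
            ≤ |(a j - a' j) * ∏ i ∈ s, a i| + |a' j * (∏ i ∈ s, a i - ∏ i ∈ s, a' i)| := abs_add_le _ _
          _ = |a j - a' j| * |∏ i ∈ s, a i| + |a' j| * |∏ i ∈ s, a i - ∏ i ∈ s, a' i| := by rw [abs_mul, abs_mul]
          _ ≤ |a j - a' j| * 1 + 1 * |∏ i ∈ s, a i - ∏ i ∈ s, a' i| :=
              add_le_add (mul_le_mul_of_nonneg_left hP (abs_nonneg _)) (mul_le_mul_of_nonneg_right h1 (abs_nonneg _))
          _ ≤ |a j - a' j| + ∑ i ∈ s, |a i - a' i| := by linarith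
  have hprod : hcube M b z - hcube M b z' = ∏ i, a i - ∏ i, a' i := rfl
  rw [hprod]
  refine (key Finset.univ).trans ?_
  calc ∑ i, |a i - a' i| ≤ ∑ _i : Fin ν, π / (2 * M) * (supDist z z' : ℝ) := Finset.sum_le_sum fun i _ => by
        refine (abs_bump_sub_bump_le hM' _ _).trans (mul_le_mul_of_nonneg_left ?_ (by positivity))
        rw [sub_sub_sub_cancel_right]
        exact abs_sub_le_supDist z z' i
    _ = ν * (π / (2 * M)) * (supDist z z' : ℝ) := by
        rw [Finset.sum_const, Finset.card_univ, Fintype.card_fin, nsmul_eq_mul]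
        ring

/-! ## §3 Overlap -/

/-- `supDist z (ctr b) < M` iff every coordinate is strictly within `M` of the centre (`M > 0`). [folklore] -/
theorem supDist_ctr_lt_iff {M : ℕ} (hM : 0 < M) (b z : Fin ν → ℤ) :
    supDist z (ctr M b) < M ↔ ∀ i, (z i - b i * M).natAbs < M := by
  rw [supDist, Finset.sup_lt_iff (bot_lt_iff_ne_bot.2 (Nat.pos_iff_ne_zero.1 hM))]
  simp [ctr]

/-- **PER AXIS AT MOST TWO**: the labels `j : Fin (q+1)` with `|t − jM| < M` (strictly) form a set of at most two elements
(two such labels differ by `< 2`). [folklore] -/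
theorem card_near_le_two {M : ℕ} (hM : 0 < M) (q : ℕ) (t : ℤ) :
    ((Finset.univ.filter fun j : Fin (q + 1) => (t - (j : ℕ) * M).natAbs < M).card : ℕ) ≤ 2 := by
  set S := Finset.univ.filter fun j : Fin (q + 1) => (t - (j : ℕ) * M).natAbs < M with hS
  by_cases hne : S.Nonempty
  · obtain ⟨m, hm, hmin⟩ := S.exists_min_image (fun j => (j : ℕ)) hne
    have hm' : (t - (m : ℕ) * M).natAbs < M := (Finset.mem_filter.1 hm).2
    -- every element is `m` or `m + 1` in value
    have hval : ∀ j ∈ S, (j : ℕ) = m ∨ (j : ℕ) = m + 1 := by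
      intro j hj
      have hj' : (t - (j : ℕ) * M).natAbs < M := (Finset.mem_filter.1 hj).2
      have hle : (m : ℕ) ≤ j := hmin j hj
      have hlt : ((j : ℕ) : ℤ) * M < ((m : ℕ) : ℤ) * M + 2 * M := by omega
      have hM' : (0 : ℤ) < M := by exact_mod_cast hM
      have : ((j : ℕ) : ℤ) < (m : ℕ) + 2 := by nlinarith
      omega
    have hsub : S.image (fun j : Fin (q + 1) => (j : ℕ)) ⊆ {(m : ℕ), (m : ℕ) + 1} := by
      intro x hx
      obtain ⟨j, hj, rfl⟩ := Finset.mem_image.1 hx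
      rcases hval j hj with h | h <;> simp [h]
    calc S.card = (S.image fun j : Fin (q + 1) => (j : ℕ)).card :=
          (Finset.card_image_of_injective S Fin.val_injective).symm
      _ ≤ ({(m : ℕ), (m : ℕ) + 1} : Finset ℕ).card := Finset.card_le_card hsub
      _ ≤ 2 := Finset.card_le_two
  · rw [Finset.not_nonempty_iff_eq_empty.1 hne]
    simp

/-- **OVERLAP `≤ 2^ν`**: at most `2^ν` labels `b : Fin ν → Fin (q+1)` have their centre strictly within sup-distance `M` of a
given point. [folklore] -/
theorem card_overlap_le {M : ℕ} (hM : 0 < M) (q : ℕ) (z : Fin ν → ℤ) :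
    (Finset.univ.filter fun b : Fin ν → Fin (q + 1) => supDist z (ctr M fun i => (b i : ℤ)) < M).card ≤ 2 ^ ν := by
  set S : Fin ν → Finset (Fin (q + 1)) := fun i => Finset.univ.filter fun j : Fin (q + 1) => (z i - (j : ℕ) * M).natAbs < M
  have hsub : (Finset.univ.filter fun b : Fin ν → Fin (q + 1) => supDist z (ctr M fun i => (b i : ℤ)) < M)
      ⊆ Fintype.piFinset S := by
    intro b hb
    rw [Finset.mem_filter] at hb
    rw [Fintype.mem_piFinset]
    intro i
    have := (supDist_ctr_lt_iff hM (fun i => (b i : ℤ)) z).1 hb.2 i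
    exact Finset.mem_filter.2 ⟨Finset.mem_univ _, by simpa using this⟩
  refine (Finset.card_le_card hsub).trans ?_
  rw [Fintype.card_piFinset]
  calc ∏ i, (S i).card ≤ ∏ _i : Fin ν, 2 := Finset.prod_le_prod' fun i _ => card_near_le_two hM q (z i)
    _ = 2 ^ ν := by simp

/-! ## §4 The partition binders for sites embedded in a box -/

section Binders

variable {Y : Type*} [Fintype Y] [DecidableEq Y]

/-- THE PARTITION FUNCTIONS on sites `e : Y → ℤ^ν`: `h_b(y) = hcube M b (e y)`, labels `b : Fin ν → Fin (q+1)`. [folklore] -/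
def hPart (M q : ℕ) (e : Y → (Fin ν → ℤ)) (b : Fin ν → Fin (q + 1)) (y : Y) : ℝ :=
  hcube M (fun i => (b i : ℤ)) (e y)

/-- THE CUBE NEIGHBOURHOODS `□̃_b = {y : supDist(e y, ctr b) < M}`. [folklore] -/
def EPart (M q : ℕ) (e : Y → (Fin ν → ℤ)) (b : Fin ν → Fin (q + 1)) : Finset Y :=
  Finset.univ.filter fun y => supDist (e y) (ctr M fun i => (b i : ℤ)) < M

omit [Fintype Y] [DecidableEq Y] in
/-- **`hsum`**: `Σ_b h_b(y)² = 1` for every site mapped into the box `[0, qM]^ν`. [folklore] -/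
theorem hPart_sq_sum {M : ℕ} (hM : 0 < M) (q : ℕ) (e : Y → (Fin ν → ℤ)) (hbox : ∀ y i, 0 ≤ e y i ∧ e y i ≤ q * M)
    (y : Y) : ∑ b, hPart M q e b y ^ 2 = 1 :=
  sum_hcube_sq_eq_one hM q (e y) (hbox y)

omit [DecidableEq Y] in
/-- **`hsupp`**: `h_b(y) = 0` off `□̃_b`. [folklore] -/
theorem hPart_supp {M : ℕ} (hM : 0 < M) (q : ℕ) (e : Y → (Fin ν → ℤ)) (b : Fin ν → Fin (q + 1)) (y : Y)
    (hy : y ∉ EPart M q e b) : hPart M q e b y = 0 := by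
  rw [EPart, Finset.mem_filter, not_and] at hy
  exact hcube_eq_zero_of_le_supDist hM (not_lt.1 (hy (Finset.mem_univ y)))

omit [Fintype Y] [DecidableEq Y] in
/-- **`habs`**: `|h_b(y)| ≤ 1`. [folklore] -/
theorem abs_hPart_le (M q : ℕ) (e : Y → (Fin ν → ℤ)) (b : Fin ν → Fin (q + 1)) (y : Y) : |hPart M q e b y| ≤ 1 :=
  abs_hcube_le_one _ _ _

omit [Fintype Y] [DecidableEq Y] in
/-- **`hLip`** (raw form): `|h_b(y) − h_b(y′)| ≤ (νπ/(2M))·supDistOn e y y′`. [folklore] -/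
theorem hPart_lipschitz {M : ℕ} (hM : 0 < M) (q : ℕ) (e : Y → (Fin ν → ℤ)) (b : Fin ν → Fin (q + 1)) (y y' : Y) :
    |hPart M q e b y - hPart M q e b y'| ≤ ν * π / (2 * M) * supDistOn e y y' := by
  have := abs_hcube_sub_hcube_le hM (fun i => (b i : ℤ)) (e y) (e y')
  unfold hPart supDistOn
  calc |hcube M (fun i => (b i : ℤ)) (e y) - hcube M (fun i => (b i : ℤ)) (e y')|
      ≤ ν * (π / (2 * M)) * (supDist (e y) (e y') : ℝ) := this
    _ = ν * π / (2 * M) * (supDist (e y) (e y') : ℝ) := by ring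

omit [Fintype Y] [DecidableEq Y] in
/-- **`hLip`** in the spine's letters: `|h_b(y) − h_b(y′)| ≤ supDistOn e y y′ / M_eff` with `M_eff = 2M/(νπ)` (`ν ≥ 1`).
[folklore] -/
theorem hPart_lipschitz' {M : ℕ} (hM : 0 < M) (hν : 0 < ν) (q : ℕ) (e : Y → (Fin ν → ℤ)) (b : Fin ν → Fin (q + 1))
    (y y' : Y) : |hPart M q e b y - hPart M q e b y'| ≤ supDistOn e y y' / (2 * M / (ν * π)) := by
  refine (hPart_lipschitz hM q e b y y').trans (le_of_eq ?_)
  have hν' : (0 : ℝ) < ν := by exact_mod_cast hν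
  have hM' : (0 : ℝ) < M := by exact_mod_cast hM
  field_simp

/-- **`hN`**: every site lies in at most `2^ν` cube neighbourhoods. [folklore] -/
theorem card_EPart_filter_le {M : ℕ} (hM : 0 < M) (q : ℕ) (e : Y → (Fin ν → ℤ)) (y : Y) :
    ((Finset.univ.filter fun b : Fin ν → Fin (q + 1) => y ∈ EPart M q e b).card : ℝ) ≤ (2 : ℝ) ^ ν := by
  have h := card_overlap_le hM q (e y)
  have hset : (Finset.univ.filter fun b : Fin ν → Fin (q + 1) => y ∈ EPart M q e b)
      = Finset.univ.filter fun b : Fin ν → Fin (q + 1) => supDist (e y) (ctr M fun i => (b i : ℤ)) < M :=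
    Finset.filter_congr fun b _ => by simp [EPart]
  rw [hset]
  exact_mod_cast h

omit [DecidableEq Y] in
/-- **`hdiam`**: `□̃_b` has `supDistOn`-diameter `≤ 2M` (in fact `< 2M`). [folklore] -/
theorem diam_EPart_le {M : ℕ} (q : ℕ) (e : Y → (Fin ν → ℤ)) (b : Fin ν → Fin (q + 1)) :
    ∀ y ∈ EPart M q e b, ∀ y' ∈ EPart M q e b, supDistOn e y y' ≤ 2 * M := by
  intro y hy y' hy'
  rw [EPart, Finset.mem_filter] at hy hy'
  have hsymm : supDist (ctr M fun i => (b i : ℤ)) (e y') = supDist (e y') (ctr M fun i => (b i : ℤ)) := by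
    unfold supDist
    exact Finset.sup_congr rfl fun i _ => by rw [← Int.natAbs_neg, neg_sub]
  have htri := supDist_triangle (e y) (ctr M fun i => (b i : ℤ)) (e y')
  rw [hsymm] at htri
  unfold supDistOn
  have : (supDist (e y) (e y') : ℝ) ≤ (supDist (e y) (ctr M fun i => (b i : ℤ)) : ℝ)
      + (supDist (e y') (ctr M fun i => (b i : ℤ)) : ℝ) := by exact_mod_cast htri
  have h1 : (supDist (e y) (ctr M fun i => (b i : ℤ)) : ℝ) < M := by exact_mod_cast hy.2
  have h2 : (supDist (e y') (ctr M fun i => (b i : ℤ)) : ℝ) < M := by exact_mod_cast hy'.2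
  linarith

end Binders

end

end Summit.QuantumFields.BalabanUV.Beta.UnitLatticePartition
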